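import Summits.QuantumFields.YangMills.Theorems.CoarseStiffnessTailCappedCoarseStiffnessLCommutatorChart
import Summits.QuantumFields.YangMills.Theorems.CoarseStiffnessTailCappedCoarseStiffnessLSlabGaussian

/-!
# Route `CoarseStiffnessTail` — ALMOST-COMMUTING TRIPLES IN `SU(2)`, LOWER HALF OF THE `ε⁴` LAW: CORE ESTIMATES
# (lead's certificate, seat `ym-line-cst-p1` g15; helper on 25301 `CappedCoarseStiffnessL`, stub S3 = uniform mean action, P2/(W3, core))

THE PICTURE.  In print's chart `g = e^{iA}`, `A ∈ ℝ³` ([Balaban1985UV3] p.260), the commutator defect is the quartic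
`K(A,X) = |A|²|X|² − (A·X)² = Σ_{p<q}(A_pX_q − A_qX_p)²` (`…LCommutatorChart`: `dist1([e^{iA},e^{iX}])² ≤ 8K(A,X)`).  A triple
`(e^{iA}, e^{iX}, e^{iX'})` with `X, X'` in the thin sheared box (the "fibre")

  `P_η(A) = {X : |X₂| ≤ 1/2, |A₂X₀ − A₀X₂| ≤ η, |A₂X₁ − A₁X₂| ≤ η}`      over      `A ∈ G = [−1/4,1/4]² × [1/2,1]`

has ALL pairwise commutators `≤ 14η` (`dist1_comm_le_of_fibre`, `dist1_comm_le_of_fibre_pair`: `K(A,X) ≤ 3η²`, `K(X,X') ≤ 24η²` by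
`2 × 2`-minor bookkeeping), the fibre has Lebesgue volume `(2η/A₂)² ≥ 4η²` (`lintegral_fibre_eq`, Mathlib's `lmarginal`), and both `G`
and the fibres sit in the quarter ball `|·| ≤ π/2` where the Haar density is `σ ≥ 2/π⁴` (`ofReal_sigmaSU2_ge`).  The companion
`…LCommVolumeLower` integrates: `Haar³{all pairwise commutators ≤ τ} ≥ c·τ⁴`.

HONEST SCOPE.  Calculus on `ℝ³` and the `SU(2)` chart; nothing of Bałaban's is asserted; the crux 25301, its stubs S1/S2/S3, `HistoryTailL`
19936 stay OPEN; `YM3TorusSU2` (R3, RECORD rung, not Clay) is NOT proved; the Yang–Mills mass gap is NOT touched.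

References: T. Bałaban, CMP **102** (1985) 255–275 [Balaban1985UV3] (p.260, `σ(A)dA`); [folklore] (almost-commuting tuples).
-/

noncomputable section

open MeasureTheory Real
open scoped ENNReal BigOperators

namespace Summit.QuantumFields.YangMills.Theorems.CoarseStiffnessTailCommVolumeLowerCore

open Literature.MathematicalPhysics.QuantumFieldTheory.Balaban1983to89
open Literature.MathematicalPhysics.QuantumFieldTheory.Balaban1983to89.B10Eq22Rescaling (sigmaSU2)
open Literature.MathematicalPhysics.QuantumFieldTheory.Balaban1983to89.B10Eq18SigmaSU2Haar (expPauli ofReal_sigmaSU2_norm)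
open Literature.Algebra.EuclideanLattices (norm_sq_fin_three inner_fin_three)
open Summit.QuantumFields.YangMills.Theorems.CoarseStiffnessTailCommutatorChart (dist1_comm_sq_le two_div_pi_le_sinc quartic_nonneg)

/-! ## §1 Minor bookkeeping: the quartic on the fibre -/

section Minors

/-- **`K(A,X) ≤ 3η²` ON THE FIBRE**: for `A ∈ G` and `X ∈ P_η(A)`. [folklore] -/
theorem quartic_le_of_fibre {A X : EuclideanSpace ℝ (Fin 3)} {η : ℝ}
    (hA0 : |A 0| ≤ 1 / 4) (hA1 : |A 1| ≤ 1 / 4) (hA2 : 1 / 2 ≤ A 2)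
    (hu : |A 2 * X 0 - A 0 * X 2| ≤ η) (hv : |A 2 * X 1 - A 1 * X 2| ≤ η) :
    ‖A‖ ^ 2 * ‖X‖ ^ 2 - inner ℝ A X ^ 2 ≤ 3 * η ^ 2 := by
  have hL : ‖A‖ ^ 2 * ‖X‖ ^ 2 - inner ℝ A X ^ 2 =
      (A 0 * X 1 - A 1 * X 0) ^ 2 + (A 2 * X 0 - A 0 * X 2) ^ 2 + (A 2 * X 1 - A 1 * X 2) ^ 2 := by
    rw [norm_sq_fin_three, norm_sq_fin_three, inner_fin_three]; ring
  rw [hL]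
  have h02 : (A 2 * X 0 - A 0 * X 2) ^ 2 ≤ η ^ 2 := by
    rw [← sq_abs]; exact pow_le_pow_left₀ (abs_nonneg _) hu 2
  have h12 : (A 2 * X 1 - A 1 * X 2) ^ 2 ≤ η ^ 2 := by
    rw [← sq_abs]; exact pow_le_pow_left₀ (abs_nonneg _) hv 2
  -- the third minor through the other two
  have hid : A 2 * (A 0 * X 1 - A 1 * X 0) = A 0 * (A 2 * X 1 - A 1 * X 2) - A 1 * (A 2 * X 0 - A 0 * X 2) := by ring
  have hb : |A 2 * (A 0 * X 1 - A 1 * X 0)| ≤ η / 2 := by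
    rw [hid]
    calc |A 0 * (A 2 * X 1 - A 1 * X 2) - A 1 * (A 2 * X 0 - A 0 * X 2)|
        ≤ |A 0 * (A 2 * X 1 - A 1 * X 2)| + |A 1 * (A 2 * X 0 - A 0 * X 2)| := abs_sub _ _
      _ = |A 0| * |A 2 * X 1 - A 1 * X 2| + |A 1| * |A 2 * X 0 - A 0 * X 2| := by rw [abs_mul, abs_mul]
      _ ≤ 1 / 4 * η + 1 / 4 * η :=
          add_le_add (mul_le_mul hA0 hv (abs_nonneg _) (by norm_num)) (mul_le_mul hA1 hu (abs_nonneg _) (by norm_num))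
      _ = η / 2 := by ring
  have hb2 : (A 2 * (A 0 * X 1 - A 1 * X 0)) ^ 2 ≤ (η / 2) ^ 2 := by
    rw [← sq_abs]; exact pow_le_pow_left₀ (abs_nonneg _) hb 2
  have hA2sq : 1 / 4 ≤ A 2 ^ 2 := by
    have h := pow_le_pow_left₀ (by norm_num : (0 : ℝ) ≤ 1 / 2) hA2 2
    norm_num at h
    exact h
  have h01 : (A 0 * X 1 - A 1 * X 0) ^ 2 ≤ η ^ 2 := by
    rw [mul_pow] at hb2
    have h := mul_le_mul_of_nonneg_left hA2sq (sq_nonneg (A 0 * X 1 - A 1 * X 0))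
    linarith
  linarith

/-- **`K(X,X') ≤ 24η²` FOR TWO POINTS OF THE SAME FIBRE** (`A ∈ G`, `X, X' ∈ P_η(A)`, `0 ≤ η ≤ 1/4`). [folklore] -/
theorem quartic_le_of_fibre_pair {A X Y : EuclideanSpace ℝ (Fin 3)} {η : ℝ} (hη : 0 ≤ η) (hη' : η ≤ 1 / 4)
    (hA0 : |A 0| ≤ 1 / 4) (hA1 : |A 1| ≤ 1 / 4) (hA2 : 1 / 2 ≤ A 2)
    (hX2 : |X 2| ≤ 1 / 2) (hu : |A 2 * X 0 - A 0 * X 2| ≤ η) (hv : |A 2 * X 1 - A 1 * X 2| ≤ η)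
    (hY2 : |Y 2| ≤ 1 / 2) (hu' : |A 2 * Y 0 - A 0 * Y 2| ≤ η) (hv' : |A 2 * Y 1 - A 1 * Y 2| ≤ η) :
    ‖X‖ ^ 2 * ‖Y‖ ^ 2 - inner ℝ X Y ^ 2 ≤ 24 * η ^ 2 := by
  have hL : ‖X‖ ^ 2 * ‖Y‖ ^ 2 - inner ℝ X Y ^ 2 =
      (X 0 * Y 1 - X 1 * Y 0) ^ 2 + (X 0 * Y 2 - X 2 * Y 0) ^ 2 + (X 1 * Y 2 - X 2 * Y 1) ^ 2 := by
    rw [norm_sq_fin_three, norm_sq_fin_three, inner_fin_three]; ring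
  rw [hL]
  -- minor (0,2): `A₂(X₀Y₂ − X₂Y₀) = uY₂ − u'X₂`
  have hid02 : A 2 * (X 0 * Y 2 - X 2 * Y 0) = (A 2 * X 0 - A 0 * X 2) * Y 2 - (A 2 * Y 0 - A 0 * Y 2) * X 2 := by ring
  have hb02 : |A 2 * (X 0 * Y 2 - X 2 * Y 0)| ≤ η := by
    rw [hid02]
    calc |(A 2 * X 0 - A 0 * X 2) * Y 2 - (A 2 * Y 0 - A 0 * Y 2) * X 2|
        ≤ |(A 2 * X 0 - A 0 * X 2) * Y 2| + |(A 2 * Y 0 - A 0 * Y 2) * X 2| := abs_sub _ _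
      _ = |A 2 * X 0 - A 0 * X 2| * |Y 2| + |A 2 * Y 0 - A 0 * Y 2| * |X 2| := by rw [abs_mul, abs_mul]
      _ ≤ η * (1 / 2) + η * (1 / 2) :=
          add_le_add (mul_le_mul hu hY2 (abs_nonneg _) hη) (mul_le_mul hu' hX2 (abs_nonneg _) hη)
      _ = η := by ring
  -- minor (1,2): `A₂(X₁Y₂ − X₂Y₁) = vY₂ − v'X₂`
  have hid12 : A 2 * (X 1 * Y 2 - X 2 * Y 1) = (A 2 * X 1 - A 1 * X 2) * Y 2 - (A 2 * Y 1 - A 1 * Y 2) * X 2 := by ring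
  have hb12 : |A 2 * (X 1 * Y 2 - X 2 * Y 1)| ≤ η := by
    rw [hid12]
    calc |(A 2 * X 1 - A 1 * X 2) * Y 2 - (A 2 * Y 1 - A 1 * Y 2) * X 2|
        ≤ |(A 2 * X 1 - A 1 * X 2) * Y 2| + |(A 2 * Y 1 - A 1 * Y 2) * X 2| := abs_sub _ _
      _ = |A 2 * X 1 - A 1 * X 2| * |Y 2| + |A 2 * Y 1 - A 1 * Y 2| * |X 2| := by rw [abs_mul, abs_mul]
      _ ≤ η * (1 / 2) + η * (1 / 2) :=
          add_le_add (mul_le_mul hv hY2 (abs_nonneg _) hη) (mul_le_mul hv' hX2 (abs_nonneg _) hη)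
      _ = η := by ring
  -- minor (0,1): `A₂²(X₀Y₁ − X₁Y₀) = A₀X₂v' + A₁Y₂u − A₁X₂u' − A₀Y₂v + (uv' − vu')`
  have hid01 : A 2 ^ 2 * (X 0 * Y 1 - X 1 * Y 0) =
      (A 0 * X 2 * (A 2 * Y 1 - A 1 * Y 2) - A 0 * Y 2 * (A 2 * X 1 - A 1 * X 2)) +
      (A 1 * Y 2 * (A 2 * X 0 - A 0 * X 2) - A 1 * X 2 * (A 2 * Y 0 - A 0 * Y 2)) +
      ((A 2 * X 0 - A 0 * X 2) * (A 2 * Y 1 - A 1 * Y 2) - (A 2 * X 1 - A 1 * X 2) * (A 2 * Y 0 - A 0 * Y 2)) := by ring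
  have hAX : |A 0 * X 2| ≤ 1 / 8 := by
    rw [abs_mul]; calc |A 0| * |X 2| ≤ 1 / 4 * (1 / 2) := mul_le_mul hA0 hX2 (abs_nonneg _) (by norm_num)
      _ = 1 / 8 := by norm_num
  have hAY : |A 0 * Y 2| ≤ 1 / 8 := by
    rw [abs_mul]; calc |A 0| * |Y 2| ≤ 1 / 4 * (1 / 2) := mul_le_mul hA0 hY2 (abs_nonneg _) (by norm_num)
      _ = 1 / 8 := by norm_num
  have hBX : |A 1 * X 2| ≤ 1 / 8 := by
    rw [abs_mul]; calc |A 1| * |X 2| ≤ 1 / 4 * (1 / 2) := mul_le_mul hA1 hX2 (abs_nonneg _) (by norm_num)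
      _ = 1 / 8 := by norm_num
  have hBY : |A 1 * Y 2| ≤ 1 / 8 := by
    rw [abs_mul]; calc |A 1| * |Y 2| ≤ 1 / 4 * (1 / 2) := mul_le_mul hA1 hY2 (abs_nonneg _) (by norm_num)
      _ = 1 / 8 := by norm_num
  have hterm : ∀ (p q r t : ℝ) (b : ℝ), |p| ≤ 1 / 8 → |q| ≤ b → |r| ≤ 1 / 8 → |t| ≤ b → 0 ≤ b →
      |p * q - r * t| ≤ b / 4 := by
    intro p q r t b hp hq hr ht hb
    calc |p * q - r * t| ≤ |p * q| + |r * t| := abs_sub _ _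
      _ = |p| * |q| + |r| * |t| := by rw [abs_mul, abs_mul]
      _ ≤ 1 / 8 * b + 1 / 8 * b := add_le_add (mul_le_mul hp hq (abs_nonneg _) (by norm_num))
          (mul_le_mul hr ht (abs_nonneg _) (by norm_num))
      _ = b / 4 := by ring
  have hcross : |(A 2 * X 0 - A 0 * X 2) * (A 2 * Y 1 - A 1 * Y 2) - (A 2 * X 1 - A 1 * X 2) * (A 2 * Y 0 - A 0 * Y 2)| ≤
      2 * η ^ 2 := by
    calc _ ≤ |(A 2 * X 0 - A 0 * X 2) * (A 2 * Y 1 - A 1 * Y 2)| + |(A 2 * X 1 - A 1 * X 2) * (A 2 * Y 0 - A 0 * Y 2)| :=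
          abs_sub _ _
      _ = |A 2 * X 0 - A 0 * X 2| * |A 2 * Y 1 - A 1 * Y 2| + |A 2 * X 1 - A 1 * X 2| * |A 2 * Y 0 - A 0 * Y 2| := by
          rw [abs_mul, abs_mul]
      _ ≤ η * η + η * η := add_le_add (mul_le_mul hu hv' (abs_nonneg _) hη) (mul_le_mul hv hu' (abs_nonneg _) hη)
      _ = 2 * η ^ 2 := by ring
  have hb01 : |A 2 ^ 2 * (X 0 * Y 1 - X 1 * Y 0)| ≤ η := by
    rw [hid01]
    have h1 := hterm _ _ _ _ η hAX hv' hAY hv hη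
    have h2 := hterm _ _ _ _ η hBY hu hBX hu' hη
    calc _ ≤ |A 0 * X 2 * (A 2 * Y 1 - A 1 * Y 2) - A 0 * Y 2 * (A 2 * X 1 - A 1 * X 2) +
            (A 1 * Y 2 * (A 2 * X 0 - A 0 * X 2) - A 1 * X 2 * (A 2 * Y 0 - A 0 * Y 2))| +
          |(A 2 * X 0 - A 0 * X 2) * (A 2 * Y 1 - A 1 * Y 2) - (A 2 * X 1 - A 1 * X 2) * (A 2 * Y 0 - A 0 * Y 2)| :=
          abs_add_le _ _
      _ ≤ (η / 4 + η / 4) + 2 * η ^ 2 := add_le_add ((abs_add_le _ _).trans (add_le_add h1 h2)) hcross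
      _ ≤ η := by
          have h := mul_le_mul_of_nonneg_left hη' hη
          nlinarith [h]
  -- squares
  have hs02 : (A 2 * (X 0 * Y 2 - X 2 * Y 0)) ^ 2 ≤ η ^ 2 := by
    rw [← sq_abs]; exact pow_le_pow_left₀ (abs_nonneg _) hb02 2
  have hs12 : (A 2 * (X 1 * Y 2 - X 2 * Y 1)) ^ 2 ≤ η ^ 2 := by
    rw [← sq_abs]; exact pow_le_pow_left₀ (abs_nonneg _) hb12 2
  have hs01 : (A 2 ^ 2 * (X 0 * Y 1 - X 1 * Y 0)) ^ 2 ≤ η ^ 2 := by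
    rw [← sq_abs]; exact pow_le_pow_left₀ (abs_nonneg _) hb01 2
  rw [mul_pow] at hs02 hs12 hs01
  have hA2sq : 1 / 4 ≤ A 2 ^ 2 := by
    have h := pow_le_pow_left₀ (by norm_num : (0 : ℝ) ≤ 1 / 2) hA2 2
    norm_num at h
    exact h
  have hA4 : 1 / 16 ≤ (A 2 ^ 2) ^ 2 := by
    have h := pow_le_pow_left₀ (by norm_num : (0 : ℝ) ≤ 1 / 4) hA2sq 2
    norm_num at h
    exact h
  have e01 : (X 0 * Y 1 - X 1 * Y 0) ^ 2 ≤ 16 * η ^ 2 := by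
    have h := mul_le_mul_of_nonneg_left hA4 (sq_nonneg (X 0 * Y 1 - X 1 * Y 0))
    linarith
  have e02 : (X 0 * Y 2 - X 2 * Y 0) ^ 2 ≤ 4 * η ^ 2 := by
    have h := mul_le_mul_of_nonneg_left hA2sq (sq_nonneg (X 0 * Y 2 - X 2 * Y 0))
    linarith
  have e12 : (X 1 * Y 2 - X 2 * Y 1) ^ 2 ≤ 4 * η ^ 2 := by
    have h := mul_le_mul_of_nonneg_left hA2sq (sq_nonneg (X 1 * Y 2 - X 2 * Y 1))
    linarith
  linarith

/-- **COMMUTATORS ON THE FIBRE**: `dist1([e^{iA}, e^{iX}]) ≤ 14η` for `A ∈ G`, `X ∈ P_η(A)`. [folklore] -/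
theorem dist1_comm_le_of_fibre {A X : EuclideanSpace ℝ (Fin 3)} {η : ℝ} (hη : 0 ≤ η)
    (hA0 : |A 0| ≤ 1 / 4) (hA1 : |A 1| ≤ 1 / 4) (hA2 : 1 / 2 ≤ A 2)
    (hu : |A 2 * X 0 - A 0 * X 2| ≤ η) (hv : |A 2 * X 1 - A 1 * X 2| ≤ η) :
    dist1 (expPauli A * expPauli X * (expPauli A)⁻¹ * (expPauli X)⁻¹) ≤ 14 * η := by
  have h1 := dist1_comm_sq_le A X
  have h2 := quartic_le_of_fibre hA0 hA1 hA2 hu hv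
  have h3 : dist1 (expPauli A * expPauli X * (expPauli A)⁻¹ * (expPauli X)⁻¹) ^ 2 ≤ (14 * η) ^ 2 := by
    nlinarith [h1, h2, sq_nonneg η]
  exact (sq_le_sq₀ (GaugeGroup.dist1_nonneg _) (by positivity)).1 h3

/-- **COMMUTATORS BETWEEN TWO POINTS OF A FIBRE**: `dist1([e^{iX}, e^{iX'}]) ≤ 14η` (`0 ≤ η ≤ 1/4`). [folklore] -/
theorem dist1_comm_le_of_fibre_pair {A X Y : EuclideanSpace ℝ (Fin 3)} {η : ℝ} (hη : 0 ≤ η) (hη' : η ≤ 1 / 4)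
    (hA0 : |A 0| ≤ 1 / 4) (hA1 : |A 1| ≤ 1 / 4) (hA2 : 1 / 2 ≤ A 2)
    (hX2 : |X 2| ≤ 1 / 2) (hu : |A 2 * X 0 - A 0 * X 2| ≤ η) (hv : |A 2 * X 1 - A 1 * X 2| ≤ η)
    (hY2 : |Y 2| ≤ 1 / 2) (hu' : |A 2 * Y 0 - A 0 * Y 2| ≤ η) (hv' : |A 2 * Y 1 - A 1 * Y 2| ≤ η) :
    dist1 (expPauli X * expPauli Y * (expPauli X)⁻¹ * (expPauli Y)⁻¹) ≤ 14 * η := by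
  have h1 := dist1_comm_sq_le X Y
  have h2 := quartic_le_of_fibre_pair hη hη' hA0 hA1 hA2 hX2 hu hv hY2 hu' hv'
  have h3 : dist1 (expPauli X * expPauli Y * (expPauli X)⁻¹ * (expPauli Y)⁻¹) ^ 2 ≤ (14 * η) ^ 2 := by
    nlinarith [h1, h2, sq_nonneg η]
  exact (sq_le_sq₀ (GaugeGroup.dist1_nonneg _) (by positivity)).1 h3

end Minors

/-! ## §2 Sizes: the box and its fibres lie in the quarter ball, where `σ ≥ 2/π⁴` -/

section Sizes

/-- `A ∈ G ⇒ ‖A‖ ≤ π/2`. [folklore] -/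
theorem norm_le_of_box {A : EuclideanSpace ℝ (Fin 3)} (hA0 : |A 0| ≤ 1 / 4) (hA1 : |A 1| ≤ 1 / 4) (hA2 : 1 / 2 ≤ A 2)
    (hA2' : A 2 ≤ 1) : ‖A‖ ≤ π / 2 := by
  have h0 : A 0 ^ 2 ≤ (1 / 4) ^ 2 := by rw [← sq_abs]; exact pow_le_pow_left₀ (abs_nonneg _) hA0 2
  have h1 : A 1 ^ 2 ≤ (1 / 4) ^ 2 := by rw [← sq_abs]; exact pow_le_pow_left₀ (abs_nonneg _) hA1 2
  have h2 : A 2 ^ 2 ≤ 1 := pow_le_one₀ (by linarith) hA2'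
  have hπ : (3 : ℝ) ^ 2 ≤ π ^ 2 := pow_le_pow_left₀ (by norm_num) Real.pi_gt_three.le 2
  have hn : ‖A‖ ^ 2 ≤ (π / 2) ^ 2 := by
    rw [norm_sq_fin_three]; nlinarith [h0, h1, h2, hπ]
  exact (sq_le_sq₀ (norm_nonneg _) (by positivity)).1 hn

/-- `X ∈ P_η(A)`, `A ∈ G`, `η ≤ 1/4` ⇒ `‖X‖ ≤ π/2`. [folklore] -/
theorem norm_le_of_fibre {A X : EuclideanSpace ℝ (Fin 3)} {η : ℝ} (hη' : η ≤ 1 / 4)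
    (hA0 : |A 0| ≤ 1 / 4) (hA1 : |A 1| ≤ 1 / 4) (hA2 : 1 / 2 ≤ A 2)
    (hX2 : |X 2| ≤ 1 / 2) (hu : |A 2 * X 0 - A 0 * X 2| ≤ η) (hv : |A 2 * X 1 - A 1 * X 2| ≤ η) : ‖X‖ ≤ π / 2 := by
  have hb : ∀ (a x : ℝ), |a| ≤ 1 / 4 → |A 2 * x - a * X 2| ≤ η → |x| ≤ 3 / 4 := by
    intro a x ha h
    have h1 : |A 2 * x| ≤ |a * X 2| + η := by
      have := abs_sub_abs_le_abs_sub (A 2 * x) (a * X 2); linarith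
    rw [abs_mul, abs_mul, abs_of_pos (by linarith : (0 : ℝ) < A 2)] at h1
    have h2 : |a| * |X 2| ≤ 1 / 4 * (1 / 2) := mul_le_mul ha hX2 (abs_nonneg _) (by norm_num)
    have h3 := mul_nonneg (by linarith : (0 : ℝ) ≤ A 2 - 1 / 2) (abs_nonneg x)
    nlinarith [h1, h2, h3, abs_nonneg x]
  have h0 := hb _ _ hA0 hu
  have h1 := hb _ _ hA1 hv
  have hs0 : X 0 ^ 2 ≤ (3 / 4) ^ 2 := by rw [← sq_abs]; exact pow_le_pow_left₀ (abs_nonneg _) h0 2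
  have hs1 : X 1 ^ 2 ≤ (3 / 4) ^ 2 := by rw [← sq_abs]; exact pow_le_pow_left₀ (abs_nonneg _) h1 2
  have hs2 : X 2 ^ 2 ≤ (1 / 2) ^ 2 := by rw [← sq_abs]; exact pow_le_pow_left₀ (abs_nonneg _) hX2 2
  have hπ : (3 : ℝ) ^ 2 ≤ π ^ 2 := pow_le_pow_left₀ (by norm_num) Real.pi_gt_three.le 2
  have hn : ‖X‖ ^ 2 ≤ (π / 2) ^ 2 := by
    rw [norm_sq_fin_three]; nlinarith [hs0, hs1, hs2, hπ]
  exact (sq_le_sq₀ (norm_nonneg _) (by positivity)).1 hn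

/-- **THE HAAR DENSITY ON THE QUARTER BALL**: `‖A‖ ≤ π/2 ⇒ σ_{SU(2)}(|A|) ≥ 2/π⁴` (Jordan: `sinc ≥ 2/π`). [cite: Balaban1985UV3, p.260] -/
theorem ofReal_sigmaSU2_ge {A : EuclideanSpace ℝ (Fin 3)} (hA : ‖A‖ ≤ π / 2) :
    ENNReal.ofReal (2 / π ^ 4) ≤ ENNReal.ofReal (sigmaSU2 ‖A‖) := by
  rw [ofReal_sigmaSU2_norm, ← ENNReal.ofReal_mul (by positivity)]
  apply ENNReal.ofReal_le_ofReal
  have hs := two_div_pi_le_sinc (norm_nonneg A) hA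
  have h2 : (2 / π) ^ 2 ≤ Real.sinc ‖A‖ ^ 2 := pow_le_pow_left₀ (by positivity) hs 2
  have heq : (2 : ℝ) / π ^ 4 = 1 / (2 * π ^ 2) * (2 / π) ^ 2 := by field_simp
  rw [heq]
  exact mul_le_mul_of_nonneg_left h2 (by positivity)

end Sizes

/-! ## §3 The Lebesgue volume of a fibre -/

section Fibre

/-- `∫ 1[|a y − c| ≤ η] dy = (2η/a)₊` for `a > 0`. [folklore] -/
theorem lintegral_indicator_affine {a : ℝ} (ha : 0 < a) (c η : ℝ) :
    ∫⁻ y : ℝ, {y : ℝ | |a * y - c| ≤ η}.indicator 1 y = ENNReal.ofReal (2 * η / a) := by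
  have hset : {y : ℝ | |a * y - c| ≤ η} = Set.Icc ((c - η) / a) ((c + η) / a) := by
    ext y
    simp only [Set.mem_setOf_eq, Set.mem_Icc, abs_le, div_le_iff₀ ha, le_div_iff₀ ha]
    constructor
    · rintro ⟨h1, h2⟩; constructor <;> linarith
    · rintro ⟨h1, h2⟩; constructor <;> linarith
  rw [hset, lintegral_indicator_one measurableSet_Icc, Real.volume_Icc]
  congr 1
  field_simp
  ring

/-- **THE FIBRE VOLUME** (`a₂ > 0`): on `Fin 3 → ℝ`,
`∫ 1[|x₂| ≤ 1/2]·1[|a₂x₀ − a₀x₂| ≤ η]·1[|a₂x₁ − a₁x₂| ≤ η] dx = (2η/a₂)²`. [folklore] -/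
theorem lintegral_fibre_eq (a : Fin 3 → ℝ) (ha : 0 < a 2) (η : ℝ) :
    ∫⁻ x : Fin 3 → ℝ, {x : Fin 3 → ℝ | |x 2| ≤ 1 / 2}.indicator 1 x *
        ({x : Fin 3 → ℝ | |a 2 * x 0 - a 0 * x 2| ≤ η}.indicator 1 x * {x : Fin 3 → ℝ | |a 2 * x 1 - a 1 * x 2| ≤ η}.indicator 1 x) =
      ENNReal.ofReal (2 * η / a 2) * ENNReal.ofReal (2 * η / a 2) := by
  classical
  -- measurability
  have hm2 : Measurable fun x : Fin 3 → ℝ => {x : Fin 3 → ℝ | |x 2| ≤ 1 / 2}.indicator (1 : (Fin 3 → ℝ) → ℝ≥0∞) x :=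
    measurable_one.indicator (measurableSet_le ((measurable_pi_apply 2).abs) measurable_const)
  have hmq : ∀ m : Fin 3, Measurable fun x : Fin 3 → ℝ =>
      {x : Fin 3 → ℝ | |a 2 * x m - a m * x 2| ≤ η}.indicator (1 : (Fin 3 → ℝ) → ℝ≥0∞) x := fun m =>
    measurable_one.indicator (measurableSet_le
      ((((measurable_pi_apply m).const_mul _).sub ((measurable_pi_apply 2).const_mul _)).abs) measurable_const)
  have hq1 : ∀ c : ℝ, Measurable fun y : ℝ => {y : ℝ | |a 2 * y - c| ≤ η}.indicator (1 : ℝ → ℝ≥0∞) y := fun c =>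
    measurable_one.indicator (measurableSet_le (((measurable_id.const_mul _).sub measurable_const).abs) measurable_const)
  have hmF : Measurable fun x : Fin 3 → ℝ => {x : Fin 3 → ℝ | |x 2| ≤ 1 / 2}.indicator (1 : (Fin 3 → ℝ) → ℝ≥0∞) x *
      ({x : Fin 3 → ℝ | |a 2 * x 0 - a 0 * x 2| ≤ η}.indicator (1 : (Fin 3 → ℝ) → ℝ≥0∞) x *
        {x : Fin 3 → ℝ | |a 2 * x 1 - a 1 * x 2| ≤ η}.indicator (1 : (Fin 3 → ℝ) → ℝ≥0∞) x) :=
    hm2.mul ((hmq 0).mul (hmq 1))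
  have hmF₁ : Measurable fun x : Fin 3 → ℝ => {x : Fin 3 → ℝ | |x 2| ≤ 1 / 2}.indicator (1 : (Fin 3 → ℝ) → ℝ≥0∞) x *
      {x : Fin 3 → ℝ | |a 2 * x 1 - a 1 * x 2| ≤ η}.indicator (1 : (Fin 3 → ℝ) → ℝ≥0∞) x * ENNReal.ofReal (2 * η / a 2) :=
    (hm2.mul (hmq 1)).mul measurable_const
  rw [volume_pi, lintegral_eq_lmarginal_univ (fun _ => (0 : ℝ))]
  have h0' : (0 : Fin 3) ∉ insert (1 : Fin 3) ({2} : Finset (Fin 3)) := by decide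
  have h1' : (1 : Fin 3) ∉ ({2} : Finset (Fin 3)) := by decide
  have huniv : insert (0 : Fin 3) (insert (1 : Fin 3) ({2} : Finset (Fin 3))) = Finset.univ := by decide
  rw [← huniv, lmarginal_insert' _ hmF h0']
  -- peel `0`
  have hstep₁ : (fun x : Fin 3 → ℝ => ∫⁻ y, {x : Fin 3 → ℝ | |x 2| ≤ 1 / 2}.indicator (1 : (Fin 3 → ℝ) → ℝ≥0∞) (Function.update x 0 y) *
      ({x : Fin 3 → ℝ | |a 2 * x 0 - a 0 * x 2| ≤ η}.indicator (1 : (Fin 3 → ℝ) → ℝ≥0∞) (Function.update x 0 y) *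
        {x : Fin 3 → ℝ | |a 2 * x 1 - a 1 * x 2| ≤ η}.indicator (1 : (Fin 3 → ℝ) → ℝ≥0∞) (Function.update x 0 y))) =
      fun x => {x : Fin 3 → ℝ | |x 2| ≤ 1 / 2}.indicator (1 : (Fin 3 → ℝ) → ℝ≥0∞) x *
        {x : Fin 3 → ℝ | |a 2 * x 1 - a 1 * x 2| ≤ η}.indicator (1 : (Fin 3 → ℝ) → ℝ≥0∞) x * ENNReal.ofReal (2 * η / a 2) := by
    funext x
    have h1 : ∀ y, {x : Fin 3 → ℝ | |x 2| ≤ 1 / 2}.indicator (1 : (Fin 3 → ℝ) → ℝ≥0∞) (Function.update x 0 y) *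
        ({x : Fin 3 → ℝ | |a 2 * x 0 - a 0 * x 2| ≤ η}.indicator (1 : (Fin 3 → ℝ) → ℝ≥0∞) (Function.update x 0 y) *
          {x : Fin 3 → ℝ | |a 2 * x 1 - a 1 * x 2| ≤ η}.indicator (1 : (Fin 3 → ℝ) → ℝ≥0∞) (Function.update x 0 y)) =
        ({x : Fin 3 → ℝ | |x 2| ≤ 1 / 2}.indicator (1 : (Fin 3 → ℝ) → ℝ≥0∞) x *
          {x : Fin 3 → ℝ | |a 2 * x 1 - a 1 * x 2| ≤ η}.indicator (1 : (Fin 3 → ℝ) → ℝ≥0∞) x) *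
          {y : ℝ | |a 2 * y - a 0 * x 2| ≤ η}.indicator (1 : ℝ → ℝ≥0∞) y := by
      intro y
      simp only [Set.indicator, Set.mem_setOf_eq, Function.update_self,
        Function.update_of_ne (show (2 : Fin 3) ≠ 0 by decide), Function.update_of_ne (show (1 : Fin 3) ≠ 0 by decide),
        Pi.one_apply]
      split_ifs <;> simp
    simp_rw [h1]
    rw [lintegral_const_mul _ (hq1 (a 0 * x 2)), lintegral_indicator_affine ha]
  rw [hstep₁, lmarginal_insert' _ hmF₁ h1']
  -- peel `1`
  have hstep₂ : (fun x : Fin 3 → ℝ => ∫⁻ y, {x : Fin 3 → ℝ | |x 2| ≤ 1 / 2}.indicator (1 : (Fin 3 → ℝ) → ℝ≥0∞) (Function.update x 1 y) *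
      {x : Fin 3 → ℝ | |a 2 * x 1 - a 1 * x 2| ≤ η}.indicator (1 : (Fin 3 → ℝ) → ℝ≥0∞) (Function.update x 1 y) *
        ENNReal.ofReal (2 * η / a 2)) =
      fun x => {x : Fin 3 → ℝ | |x 2| ≤ 1 / 2}.indicator (1 : (Fin 3 → ℝ) → ℝ≥0∞) x *
        (ENNReal.ofReal (2 * η / a 2) * ENNReal.ofReal (2 * η / a 2)) := by
    funext x
    have h1 : ∀ y, {x : Fin 3 → ℝ | |x 2| ≤ 1 / 2}.indicator (1 : (Fin 3 → ℝ) → ℝ≥0∞) (Function.update x 1 y) *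
        {x : Fin 3 → ℝ | |a 2 * x 1 - a 1 * x 2| ≤ η}.indicator (1 : (Fin 3 → ℝ) → ℝ≥0∞) (Function.update x 1 y) *
          ENNReal.ofReal (2 * η / a 2) =
        ({x : Fin 3 → ℝ | |x 2| ≤ 1 / 2}.indicator (1 : (Fin 3 → ℝ) → ℝ≥0∞) x * ENNReal.ofReal (2 * η / a 2)) *
          {y : ℝ | |a 2 * y - a 1 * x 2| ≤ η}.indicator (1 : ℝ → ℝ≥0∞) y := by
      intro y
      simp only [Set.indicator, Set.mem_setOf_eq, Function.update_self,
        Function.update_of_ne (show (2 : Fin 3) ≠ 1 by decide), Pi.one_apply]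
      split_ifs <;> simp
    simp_rw [h1]
    rw [lintegral_const_mul _ (hq1 (a 1 * x 2)), lintegral_indicator_affine ha]
    ring
  rw [hstep₂, lmarginal_singleton]
  -- the last coordinate
  have h1 : ∀ y : ℝ, {x : Fin 3 → ℝ | |x 2| ≤ 1 / 2}.indicator (1 : (Fin 3 → ℝ) → ℝ≥0∞) (Function.update (fun _ => (0 : ℝ)) 2 y) *
      (ENNReal.ofReal (2 * η / a 2) * ENNReal.ofReal (2 * η / a 2)) =
      (Set.Icc (-(1 / 2 : ℝ)) (1 / 2)).indicator (fun _ => ENNReal.ofReal (2 * η / a 2) * ENNReal.ofReal (2 * η / a 2)) y := by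
    intro y
    simp only [Set.indicator, Set.mem_setOf_eq, Function.update_self, Set.mem_Icc, abs_le, Pi.one_apply]
    split_ifs <;> simp
  simp_rw [h1]
  rw [lintegral_indicator_const measurableSet_Icc, Real.volume_Icc]
  rw [show (1 / 2 : ℝ) - -(1 / 2) = 1 by ring, ENNReal.ofReal_one, mul_one]

end Fibre

end Summit.QuantumFields.YangMills.Theorems.CoarseStiffnessTailCommVolumeLowerCore

end
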